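import Summits.BirchSwinnertonDyer.Rank1Residual.GaloisImage.KolyvaginSystemRestriction
import Summits.BirchSwinnertonDyer.Rank1Residual.GaloisImage.KolyvaginScalarTransportLocal
import Summits.BirchSwinnertonDyer.Rank1Residual.GaloisImage.PropagatedStructure
import HarnessLib

/-!
# Route `KimAtThreeKolyvagin` (rung W2), crux `StubAtEmptyLevelThree` (item 19561): LIFTABILITY of the
# bottom class through a core vertex (the input (ii) of `KimAtThreeStubOfLiftable`)

Cell `bsd-addord`, seat `bsd-addord-w2-c2` (gen 3). TOOL FILE: theorems only, no definition, no named fact,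
no `sorry`; closes nothing; books nothing. HONEST FRAMING: BSD is not proved by any of this; item 19561 stays
OPEN. This file reduces the liftability input of the "stub from liftability" road (Mazur–Rubin Thm. 4.4.3
at the vertex `∅`, files `KimAtThreeStubOfLiftableAlgebra` / `KimAtThreeStubOfLiftable`) to three
displayed inputs, each the shape of ONE tree theorem of cell n1011.

## The argument (Mazur–Rubin, Mem. AMS 799, proof of Thm. 4.4.1 Case 3 / Prop. 5.2.9 shape, at two
depths `k ≤ k̃`)

Let `g` be a Kolyvagin system for `(E[3^{k+1}], 𝓕_can, 𝒫_k)` and `g̃` one for `(E[3^{k̃+1}], 𝓕_can, 𝒫̃)`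
with `𝒫̃ ⊆ 𝒫_k` (the deeper pinned class), and `red : E[3^{k̃+1}] → E[3^{k+1}]` the reduction. Restrict
`g` to `𝒫̃` (cell n1011 `KSRestrict.isKolyvaginSystem_restrictPrimes`: same bottom class) and push `g̃`
forward along `red` (input (L-b), the shape of `KSDevissage.isKolyvaginSystem_map`). If at ONE level
`d₀ ⊆ 𝒫̃` the two systems are proportional, `red_*(g̃_{d₀}) = w·g_{d₀}` with `3 ∤ w` (input (L-c): at a
core vertex both `g_{d₀}` and `g̃_{d₀}` generate the free rank-one stalks and `red_*` is onto — the
shape of `Transport.pow_dvd_iff_of_comp`'s steps S2–S3), and evaluation at `d₀` is injective on the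
Kolyvagin systems of the restricted datum (input (L-a): `TorsionLevel.injective_eval_kolyvaginSystems_allDepths`
over the `m = 1` rigidity at the core vertex `d₀`), then `red_* ∘ g̃ − w·g|_{𝒫̃}` vanishes at `d₀`, hence
at `∅`: `red_*(g̃_∅) = w·g_∅`, and inverting the unit `w` modulo `3^{k+1}`:
**`g_∅ = red_*(a·g̃_∅)` with `a·g̃_∅ ∈ H¹_{𝓕_can}(ℚ, E[3^{k̃+1}])`** — the bottom class is LIFTABLE.

* `apply_empty_eq_zsmul_of_coreVertex` — `red_*(g̃_∅) = w·g_∅` from (L-a), (L-b), (L-c).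
* `exists_lift_apply_empty_of_coreVertex` — `∃ y ∈ H¹_{𝓕_can}(ℚ, E[3^{k̃+1}]), red_* y = g_∅`, the
  hypothesis `hx` of `KimAtThreeStubOfLiftable.stubShape_of_liftable_three_of_surj`.

References: [MazurRubin2004] Thm. 4.4.1 (Case 3, p. 46), Thm. 4.4.3 (pp. 46–47), Prop. 5.2.9;
[Sakamoto2024] Def. 4.1, Thm. 4.4; [Rubin2011] Def. 2.2.1, Cor. 2.8.9.
-/

-- the Theorems namespace of a single-conjunct summit repeats the summit name by design (D-0017)
set_option linter.dupNamespace false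

noncomputable section

open scoped Classical NumberField ContRepresentation
open Field NumberField IsDedekindDomain WeierstrassCurve Literature.NumberTheory.EllipticCurves
  Literature.NumberTheory.GaloisRepresentations Literature.NumberTheory.GaloisRepresentations.DiscreteGaloisModule
  Literature.NumberTheory.GaloisCohomology Literature.NumberTheory.GaloisCohomology.KolyvaginDatum
  Summit.BirchSwinnertonDyer.Rank1Residual.GaloisImage

namespace Summit.BirchSwinnertonDyer.BirchSwinnertonDyer.Theorems.KimAtThreeStubOfLiftable

variable (W : WeierstrassCurve ℚ) [W.IsElliptic] (k kt : ℕ)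

/-- **Proportionality at a core vertex propagates to the bottom class.** With `g`, `g̃`, `red` as in
the module docstring, (L-b) the push-forward `red_* ∘ g̃` a Kolyvagin system for the datum of `g`
restricted to `𝒫̃`, (L-a) evaluation at `d₀` injective on those systems (vanishing at `d₀` ⟹ vanishing
at `∅`), (L-c) `red_*(g̃_{d₀}) = w·g_{d₀}` at a level `d₀ ⊆ 𝒫̃`: then `red_*(g̃_∅) = w·g_∅`.
[cite: MazurRubin2004, Thm. 4.4.1 (Case 3, p. 46)] [cite: Sakamoto2024, Def. 4.1 (p. 926)] -/
theorem apply_empty_eq_zsmul_of_coreVertex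
    (red : (W.torsionGaloisModule (((3 : ℕ) : ℤ) ^ kt * ((3 : ℕ) : ℤ))).toContRepresentation →ⁱL
      (W.torsionGaloisModule (((3 : ℕ) : ℤ) ^ k * ((3 : ℕ) : ℤ))).toContRepresentation)
    {Dk : KolyvaginDatum (W.torsionGaloisModule (((3 : ℕ) : ℤ) ^ k * ((3 : ℕ) : ℤ)))}
    {P : Set (HeightOneSpectrum (𝓞 ℚ))} (hPP : P ⊆ Dk.primes)
    {g : Finset (HeightOneSpectrum (𝓞 ℚ)) →
      galoisCohomology (W.torsionGaloisModule (((3 : ℕ) : ℤ) ^ k * ((3 : ℕ) : ℤ))) 1}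
    (hg : Dk.IsKolyvaginSystem (propagatedSelmerStructure W 3 k) g)
    {gt : Finset (HeightOneSpectrum (𝓞 ℚ)) →
      galoisCohomology (W.torsionGaloisModule (((3 : ℕ) : ℤ) ^ kt * ((3 : ℕ) : ℤ))) 1}
    -- (L-b) the push-forward of `g̃` along `red` is a Kolyvagin system for the restricted datum
    (hmap : ({ Dk with primes := P } : KolyvaginDatum _).IsKolyvaginSystem (propagatedSelmerStructure W 3 k)
      fun d => galoisCohomology.map red 1 (gt d))
    -- (L-a) rigidity at `d₀` on the Kolyvagin systems of the restricted datum
    {d₀ : Finset (HeightOneSpectrum (𝓞 ℚ))}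
    (hinj : ∀ s : Finset (HeightOneSpectrum (𝓞 ℚ)) →
        galoisCohomology (W.torsionGaloisModule (((3 : ℕ) : ℤ) ^ k * ((3 : ℕ) : ℤ))) 1,
      ({ Dk with primes := P } : KolyvaginDatum _).IsKolyvaginSystem (propagatedSelmerStructure W 3 k) s →
        s d₀ = 0 → s ∅ = 0)
    -- (L-c) proportionality at the level `d₀ ⊆ 𝒫̃`
    (hd₀ : (↑d₀ : Set (HeightOneSpectrum (𝓞 ℚ))) ⊆ P) {w : ℤ}
    (hcmp : galoisCohomology.map red 1 (gt d₀) = w • g d₀) :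
    galoisCohomology.map red 1 (gt ∅) = w • g ∅ := by
  -- the restriction of `g` to `P`
  set gr : Finset (HeightOneSpectrum (𝓞 ℚ)) →
      galoisCohomology (W.torsionGaloisModule (((3 : ℕ) : ℤ) ^ k * ((3 : ℕ) : ℤ))) 1 :=
    fun d => if (↑d : Set (HeightOneSpectrum (𝓞 ℚ))) ⊆ P then g d else 0 with hgr_def
  have hgr : ({ Dk with primes := P } : KolyvaginDatum _).IsKolyvaginSystem
      (propagatedSelmerStructure W 3 k) gr := KSRestrict.isKolyvaginSystem_restrictPrimes hg hPP
  have hgr₀ : gr d₀ = g d₀ := if_pos hd₀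
  have hgr₁ : gr ∅ = g ∅ := if_pos (by simp)
  -- the difference system `s = red_* ∘ g̃ - w • gr`
  set KS := ({ Dk with primes := P } : KolyvaginDatum _).kolyvaginSystems (propagatedSelmerStructure W 3 k)
  have hs_mem : (fun d => galoisCohomology.map red 1 (gt d)) - w • gr ∈ KS :=
    KS.sub_mem ((mem_kolyvaginSystems_iff _ _ _).mpr hmap)
      (KS.zsmul_mem ((mem_kolyvaginSystems_iff _ _ _).mpr hgr) w)
  have hs : ({ Dk with primes := P } : KolyvaginDatum _).IsKolyvaginSystem (propagatedSelmerStructure W 3 k)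
      ((fun d => galoisCohomology.map red 1 (gt d)) - w • gr) := (mem_kolyvaginSystems_iff _ _ _).mp hs_mem
  have hs₀ : ((fun d => galoisCohomology.map red 1 (gt d)) - w • gr) d₀ = 0 := by
    simp only [Pi.sub_apply, Pi.smul_apply, hgr₀, hcmp, sub_self]
  have h := hinj _ hs hs₀
  simp only [Pi.sub_apply, Pi.smul_apply, hgr₁] at h
  exact sub_eq_zero.mp h

/-- **LIFTABILITY of the bottom class through a core vertex.** Under (L-a), (L-b), (L-c) with `3 ∤ w`
(`IsCoprime w 3`) and `g̃_∅ ∈ H¹_{𝓕_can}(ℚ, E[3^{k̃+1}])` (any Kolyvagin system's bottom class,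
`IsKolyvaginSystem.apply_empty_mem`): `g_∅ = red_*(a·g̃_∅)` for the inverse `a` of `w` modulo `3^{k+1}`,
so `∃ y ∈ H¹_{𝓕_can}(ℚ, E[3^{k̃+1}]), red_* y = g_∅` — the liftability hypothesis `hx` of
`KimAtThreeStubOfLiftable.stubShape_of_liftable_three_of_surj`.
[cite: MazurRubin2004, Thm. 4.4.3 (pp. 46–47) and Prop. 5.2.9] [cite: Sakamoto2024, Def. 4.1 (p. 926)] -/
theorem exists_lift_apply_empty_of_coreVertex
    (red : (W.torsionGaloisModule (((3 : ℕ) : ℤ) ^ kt * ((3 : ℕ) : ℤ))).toContRepresentation →ⁱL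
      (W.torsionGaloisModule (((3 : ℕ) : ℤ) ^ k * ((3 : ℕ) : ℤ))).toContRepresentation)
    {Dk : KolyvaginDatum (W.torsionGaloisModule (((3 : ℕ) : ℤ) ^ k * ((3 : ℕ) : ℤ)))}
    {Dt : KolyvaginDatum (W.torsionGaloisModule (((3 : ℕ) : ℤ) ^ kt * ((3 : ℕ) : ℤ)))}
    (hPP : Dt.primes ⊆ Dk.primes)
    {g : Finset (HeightOneSpectrum (𝓞 ℚ)) →
      galoisCohomology (W.torsionGaloisModule (((3 : ℕ) : ℤ) ^ k * ((3 : ℕ) : ℤ))) 1}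
    (hg : Dk.IsKolyvaginSystem (propagatedSelmerStructure W 3 k) g)
    {gt : Finset (HeightOneSpectrum (𝓞 ℚ)) →
      galoisCohomology (W.torsionGaloisModule (((3 : ℕ) : ℤ) ^ kt * ((3 : ℕ) : ℤ))) 1}
    (hgt : Dt.IsKolyvaginSystem (propagatedSelmerStructure W 3 kt) gt)
    (hmap : ({ Dk with primes := Dt.primes } : KolyvaginDatum _).IsKolyvaginSystem
      (propagatedSelmerStructure W 3 k) fun d => galoisCohomology.map red 1 (gt d))
    {d₀ : Finset (HeightOneSpectrum (𝓞 ℚ))}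
    (hinj : ∀ s : Finset (HeightOneSpectrum (𝓞 ℚ)) →
        galoisCohomology (W.torsionGaloisModule (((3 : ℕ) : ℤ) ^ k * ((3 : ℕ) : ℤ))) 1,
      ({ Dk with primes := Dt.primes } : KolyvaginDatum _).IsKolyvaginSystem
          (propagatedSelmerStructure W 3 k) s → s d₀ = 0 → s ∅ = 0)
    (hd₀ : Dt.IsLevel d₀) {w : ℤ} (hw : IsCoprime w 3)
    (hcmp : galoisCohomology.map red 1 (gt d₀) = w • g d₀) :
    ∃ y ∈ (propagatedSelmerStructure W 3 kt).selmerGroup, galoisCohomology.map red 1 y = g ∅ := by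
  have h := apply_empty_eq_zsmul_of_coreVertex W k kt red hPP hg hmap hinj hd₀ hcmp
  -- invert `w` modulo `3^{k+1}`
  obtain ⟨a, b, hab⟩ := (hw.pow_right (n := k + 1))
  refine ⟨a • gt ∅, (propagatedSelmerStructure W 3 kt).selmerGroup.zsmul_mem hgt.apply_empty_mem a, ?_⟩
  rw [map_zsmul, h, smul_smul]
  have hkill : ((3 : ℤ) ^ (k + 1)) • g ∅ = 0 := by
    rw [show ((3 : ℤ) ^ (k + 1)) = ((3 ^ (k + 1) : ℕ) : ℤ) by push_cast; rfl, natCast_zsmul]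
    exact Transport.pow_succ_nsmul_galoisCohomology W k _
  have e : a * w = 1 - b * 3 ^ (k + 1) := eq_sub_of_add_eq hab
  rw [e, sub_zsmul, one_zsmul, mul_zsmul, hkill, smul_zero]
  simp

end Summit.BirchSwinnertonDyer.BirchSwinnertonDyer.Theorems.KimAtThreeStubOfLiftable

end
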